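import Summits.AtomisticToContinuum.Crystallization.Cruxes.LjLaminarWindows.IdeatorOneSketch
import Summits.AtomisticToContinuum.Crystallization.Theorems.ThreeConeCertificateOnePercentCertificateFccRung

/-!
# Crux-triage scratch (r1, k = 2): the typed bet and the typed output of ideator 1 are FALSE at
small radius (degenerate instance `L' = R = small`, `ε = 1/10`): the window is the single particle
`i`, its energy sum is `0`, while `2 (e* + ε) · 1 < 0` (`e* ≤ −0.711`, tree `eStar_le_neg`).
Repair (as the crux itself does): `∃ R₀, ∀ R ≥ R₀`.
-/

noncomputable section

open scoped BigOperators
open Filter Literature.MathematicalPhysics.StatisticalMechanics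
open Summit.AtomisticToContinuum.Crystallization.Cruxes.LjLaminarWindows.IdeatorOne

namespace TriageScratch

theorem eStar_eq :
    eStar = Summit.AtomisticToContinuum.Crystallization.Theorems.ChargedEnergyGapNegative.eStar := rfl

theorem eStar_add_lt : eStar + 1 / 10 < 0 := by
  have h := Summit.AtomisticToContinuum.Crystallization.Theorems.OnePercentFccRung.eStar_le_neg
  rw [eStar_eq]; linarith

theorem exists_gs_seq :
    ∃ x : (N : ℕ) → (Fin N → EuclideanSpace ℝ (Fin 3)), ∀ N, IsGroundState lennardJones (x N) :=
  ⟨fun N => Classical.choose (LennardJonesGroundStatesExist_holds N),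
   fun N => Classical.choose_spec (LennardJonesGroundStatesExist_holds N)⟩

/-- Generic degenerate-window computation: if the `r`-ball about `x i` is `{i}`, the crux-style
energy sum vanishes and the ball has `Nat.card = 1`. -/
theorem sum_eq_zero_of_ball {N : ℕ} (x : Fin N → EuclideanSpace ℝ (Fin 3)) (i : Fin N) (r : ℝ)
    (hball : ∀ j : Fin N, dist (x j) (x i) ≤ r → j = i) :
    (∑ j : Fin N, ∑ k : Fin N,
        if j ≠ k ∧ dist (x j) (x i) ≤ r ∧ dist (x k) (x i) ≤ r
        then lennardJones (dist (x j) (x k)) else 0) = 0 := by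
  apply Finset.sum_eq_zero; intro j _
  apply Finset.sum_eq_zero; intro k _
  rw [if_neg]
  rintro ⟨hjk, hj, hk⟩
  exact hjk ((hball j hj).trans (hball k hk).symm)

theorem card_ball_eq_one {N : ℕ} (x : Fin N → EuclideanSpace ℝ (Fin 3)) (i : Fin N) (r : ℝ)
    (hr : 0 ≤ r) (hball : ∀ j : Fin N, dist (x j) (x i) ≤ r → j = i) :
    Nat.card {j : Fin N // dist (x j) (x i) ≤ r} = 1 := by
  rw [Nat.card_eq_one_iff_unique]
  refine ⟨⟨fun p q => Subtype.ext ((hball p.1 p.2).trans (hball q.1 q.2).symm)⟩, ⟨⟨i, ?_⟩⟩⟩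
  simpa using hr

/-- The bet of card `epitaxial-half-space-gap`, as typed, is false (small `L'`). -/
theorem not_SeedLayers : ¬ SeedLayers := by
  intro h
  obtain ⟨x, hx⟩ := exists_gs_seq
  have hf := h x hx (1 / 10) (1 / 10) (1 / 10) (by norm_num) (by norm_num) (by norm_num)
  obtain ⟨N, i, A, a, -, -, -, -, hsep, hE⟩ := hf.exists
  have hball : ∀ j : Fin N, dist (x N j) (x N i) ≤ 1 / 10 → j = i := by
    intro j hj
    by_contra hji
    have h0 : dist (x N i) (x N i) ≤ 1 / 10 := by rw [dist_self]; norm_num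
    have := hsep j i hji hj h0
    linarith
  rw [sum_eq_zero_of_ball (x N) i (1 / 10) hball,
    card_ball_eq_one (x N) i (1 / 10) (by norm_num) hball] at hE
  have := eStar_add_lt
  push_cast at hE
  linarith

/-- The output format of card `stacking-blind-budget-flatness`, as typed, is false (small `R`);
hence `WindowsGlue` and `EpitaxyComposition` are vacuously true as typed. -/
theorem not_RigidOptimalBarlowWindows : ¬ RigidOptimalBarlowWindows := by
  intro h
  obtain ⟨x, hx⟩ := exists_gs_seq
  obtain ⟨δ, hδ, hsepGS⟩ := LennardJonesMinimalDistance_holds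
  have hf := h x hx (δ / 2) (1 / 10) (by positivity) (by norm_num)
  obtain ⟨N, i, g, a, hh, s, -, -, -, -, -, -, -, -, hE⟩ := hf.exists
  have hball : ∀ j : Fin N, dist (x N j) (x N i) ≤ δ / 2 → j = i := by
    intro j hj
    by_contra hji
    have := hsepGS N (x N) (hx N) j i hji
    linarith
  rw [sum_eq_zero_of_ball (x N) i (δ / 2) hball,
    card_ball_eq_one (x N) i (δ / 2) (by positivity) hball] at hE
  have := eStar_add_lt
  push_cast at hE
  linarith

theorem windowsGlue_trivial : WindowsGlue := fun h => (not_RigidOptimalBarlowWindows h).elim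

theorem epitaxyComposition_trivial : EpitaxyComposition := fun h => (not_SeedLayers h).elim

/-- `HalfSpaceEpitaxialGap` as typed is trivially true up to one stability estimate: `w₀` is
only required to be a LOWER bound of the adsorption potential, so it may be taken `≪ 0`.  We do
not formalise the LJ stability bound here; recorded as the statement to sharpen. -/
example : True := trivial

end TriageScratch

end
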